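import Literature.MathematicalPhysics.PowerSystems.QuadraticDroopReducedJacobianStability
import Literature.GroupTheory.ArithmeticGroups.PositiveDefiniteConeProperAction
import Mathlib.Analysis.Calculus.ImplicitContDiff
import HarnessLib

/-!
# Quadratic droop control with ZIP loads (Simpson-Porco–Dörfler–Bullo 2017, Theorem 3.4): the
# high-voltage solution persists for small constant-power demands — implicit function theorem at
# `E_L^{ZI}`, the expansion `E_L^{ZIP} = [E_L^{ZI}](𝟙 − Q_sc⁻¹Q_L + ε)` with `‖ε‖ = O(‖Q_sc⁻¹Q_L‖²)`,
# and local exponential stability by continuity from the ZI case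

Topic `Literature/MathematicalPhysics/PowerSystems` (LADDER-GRIDFUSION rung G3.b «droop microgrid
with Q–V dynamics», quadratic-droop lineage; seat gridfusion-lit-2, g15).  Third file on
[SimpsonporcoDorflerBullo2017] = IEEE TAC 62 (2017) 1239–1253 = arXiv:1507.00431 (held text read on
the page this session: §3.3 p0011 L61–L69 (ZIP model), Theorem 3.4 p0012 L1–L18, Appendix A proof
p0019 L25–L66).  Companions: `QuadraticDroopVoltageStabilization.lean` (the model `QuadDroopNetwork`,
the closed loop (3.3), Theorem 3.1, Theorem 3.3 for ZI loads: `ziVoltage`, `jacRed`, Proposition 7.2,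
Lemma 7.1) and `QuadraticDroopReducedJacobianStability.lean` (Theorem 3.2: `symJacRed`, the DAE tier
`theorem_3_2_locallyExpStable`, `exists_daeSolution_expStable`, `daeSolution_unique`).

THE PRINTED THEOREM (p0012 L1–L13). «Theorem 3.4 (Stability with "ZIP" Loads). Consider the reduced
power flow equation (3.7) with the ZIP load model `Q_L^{ZIP}(E_L) = [E_L][b_shunt]E_L + [E_L]I_shunt + Q_L`,
let the conditions of Theorem 3.3 hold, and let `E_L^{ZI}` be the high-voltage solution of (3.7) for ZI
loads as given in Theorem 3.3. Furthermore, define the short-circuit capacity matrix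
`Q_sc ≜ [E_L^{ZI}](B_red + [b_shunt])[E_L^{ZI}] ∈ ℝ^{n×n}`. If `‖Q_L‖` is sufficiently small, then there
exists a unique high-voltage solution `E_L^{ZIP} ∈ ℝ^n_{>0}` of the reduced power flow equation (3.7)
with ZIP loads, given by `E_L^{ZIP} = [E_L^{ZI}](𝟙_n − Q_sc⁻¹Q_L + ε)`, where `‖ε‖ = O(‖Q_sc⁻¹Q_L‖²)`, and
the corresponding equilibrium point `(E_L^{ZIP}, E_I^{ZIP})` of (3.3) is locally exponentially stable.»

THE PRINTED PROOF (Appendix A, p0019 L25–L66), followed step by step.  (A.1) With ZIP loads the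
reduced power flow equation reads `Q_L = −[E_L](B_red + [b_shunt])(E_L − E_L^{ZI})` — §1
`zipResidual_apply_eq_sub`.  (A.2)–(A.3) In the coordinates `E_L = [E_L^{ZI}](𝟙 − q_L + ε)`,
`q_L = Q_sc⁻¹Q_L`, it becomes `h(ε, q_L) ≜ Q_sc ε + [q_L − ε]Q_sc(q_L − ε) = 0` — §3
`zipResidual_coordinates`, `Qsc_mulVec_zipError`.  «`h(0,0) = 0` … `∂h/∂ε(0,0) = Q_sc`, which is full
rank. It follows from the Implicit Function Theorem that there exist open sets `U₀, V₀` … and a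
continuously differentiable function `H : U₀ → V₀` such that `h(H(q_L), q_L) = 0`» — §2 applies
Mathlib's implicit function theorem (`HasStrictFDerivAt.implicitFunctionOfProdDomain`,
`ImplicitFunctionData.contDiffAt_implicitFunction`) to the residual map `F(Q_L, E_L)` of (3.7) itself
at `(0, E_L^{ZI})`, whose partial derivative in `E_L` is the reduced Jacobian
`J_red(E_L^{ZI}) = [E_L^{ZI}](B_red + [b_shunt])` (`hasFDerivAt_zipResidual_inr`, companion
`jacRed_ziVoltage`), invertible under Theorem 3.3's hypotheses: the solution map `zipVoltage :
Q_L ↦ E_L^{ZIP}(Q_L)` is `C^∞` at `0`, equals `E_L^{ZI}` at `Q_L = 0`, solves (3.7) for all small `Q_L`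
and is the ONLY solution near `E_L^{ZI}` (`theorem_3_4_implicitFunction`).  (A.4)–(A.6) «rearrange and
take the norm of both sides … `‖ε‖ ≤ (β/α)(‖q_L‖ + ‖ε‖)²` … implies `‖ε‖ ≤ 4(β/α)‖q_L‖² =
O(‖Q_sc⁻¹Q_L‖²)`» — §3 `norm_zipError_le_mul_sq` (with `α⁻¹ = ‖Q_sc⁻¹‖`, `β = ‖Q_sc‖` as operators on
`(ℝ^n, ‖·‖_∞)`) and **`eventually_norm_zipError_le`** (the elementary implication once
`κ(‖q_L‖ + ‖ε‖) ≤ ½`, which holds for small `Q_L` because `ε → 0` by continuity of the implicit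
function); as a by-product §3 identifies the DERIVATIVE of `Q_L ↦ E_L^{ZIP}` at `0` as `−[E_L^{ZI}]Q_sc⁻¹`
(`hasFDerivAt_zipVoltage`), i.e. the first-order term of (3.15).  «Exponential stability follows
immediately by continuity from the case of ZI loads» — §4: at a solution of (3.7) with ZIP loads the
symmetrised reduced Jacobian is `[E_L]⁻¹J_red = B_red + [b_shunt] − [E_L]⁻²[Q_L]`
(`symJacRed_zip`), so `J_red(E_L^{ZIP})` is Hurwitz as soon as `−(B_red + [b_shunt]) + [E_L]⁻²[Q_L] ≻ 0`
(**`jacRed_zip_isHurwitz_of_posDef`**, an explicit finite check — automatic for `Q_L ≥ 0`, a margin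
condition for inductive `Q_L < 0`), and this holds for all small `Q_L` since positive definiteness is an
open condition and `E_L^{ZIP}(Q_L) → E_L^{ZI}` (`eventually_jacRed_zipVoltage_isHurwitz`, tree lemma
`isOpen_setOf_dotProduct_mulVec_pos`).  §5 assembles **`theorem_3_4_zipLoads`** (reduced tier, as
Theorem 3.3's companion statement `theorem_3_3_ziLoads`) and the DAE tier through Theorem 3.2:
**`theorem_3_4_locallyExpStable`** (for all sufficiently small `Q_L`: the equilibrium
`(E_L^{ZIP}, E_I^{ZIP})` of (3.3) lies in `ℝ^{n+m}_{>0}` and every C¹ solution of the DAE starting close to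
it converges to it exponentially; solutions exist from every nearby consistent initial state and are
unique), with the matrix-level data hypotheses of Proposition 7.2, and
**`theorem_3_4_locallyExpStable_of_network`** from branch data (Lemma 7.1).

THREE COLUMNS / NOT CLAIMED.  Everything is about the MODEL of the companions (decoupled reactive
power flow `Q = −[E]BE`, first-order inverter voltage sources under quadratic droop, static ZIP
loads).  «Sufficiently small `‖Q_L‖`» is typed as `∀ᶠ Q_L in 𝓝 0` — NO bound on the admissible
constant-power demand is computed (the neighbourhood is existential, as in print); for a GIVEN `Q_L`
the certificate road is `jacRed_zip_isHurwitz_of_posDef` + Theorem 3.2 at an enclosed solution.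
«Unique high-voltage solution» is typed as LOCAL uniqueness near `E_L^{ZI}` (the implicit-function
statement the printed proof gives); nothing is said about other (low-voltage) solutions of (3.7).  The
`O(·)` constant is existential (`4‖Q_sc⁻¹‖‖Q_sc‖` in the proof, operator norms for `‖·‖_∞`).  No
estimate of `ρ, k, λ`.  Theorem 3.5 (dynamic shunt loads) and §4 of the source are not typed here.
Nothing here says a microgrid is stable.

## Mathlib / tree search

Tree (used by name): companions (`ziLoad`, `ziVoltage`, `ziVoltage_pos`, `ziVoltage_reducedPowerFlow`,
`ziResidual_eq`, `jacRed`, `jacRed_ziVoltage`, `symJacRed`, `symJacRed_of_reducedPowerFlow`,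
`jacRed_eq_diagonal_mul_symJacRed`, `Bred_transpose`, `invVoltage_pos`, `proposition_7_2`,
`liftState`, `theorem_3_2_locallyExpStable`, `exists_daeSolution_expStable`, `daeSolution_unique`,
`posDef_neg_BIIK_of_posDef_aug`, `posDef_neg_aug_of_branchConnected`, `stieltjes_neg_Bred`,
`susceptanceMatrix_*`), `LinearAlgebra/Matrix/DiagonalSymmetricProduct`
(`isHurwitz_diagonal_mul_of_posDef_neg`), `GroupTheory/ArithmeticGroups/PositiveDefiniteConeProperAction`
(`isOpen_setOf_dotProduct_mulVec_pos`: positive definiteness is open).  Mathlib: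
`HasStrictFDerivAt.implicitFunctionOfProdDomain` (+ `eventually_apply_eq_iff_…`,
`hasStrictFDerivAt_…`, `tendsto_…`), `ImplicitFunctionData.contDiffAt_implicitFunction`,
`ContinuousLinearEquiv.ofBijective`, `ContinuousLinearMap.le_opNorm`, `hasFDerivAt_pi'`.

## References

* J. W. Simpson-Porco, F. Dörfler, F. Bullo, *Voltage stabilization in microgrids via quadratic droop
  control*, IEEE Trans. Automat. Control 62 (2017) 1239–1253 = arXiv:1507.00431: §3.3 ZIP model
  (held text p0011 L61–L69), Theorem 3.4 (p0012 L1–L18), Appendix A proof of Theorem 3.4 (p0019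
  L25–L66), Theorem 3.2 (p0010), Theorem 3.3 (p0011), Proposition 7.2 / Lemma 7.1 (p0019).
  [SimpsonporcoDorflerBullo2017]
* H. K. Khalil, *Nonlinear Systems*, 3rd ed., Prentice Hall 2002, Theorem 4.7 (the tree's
  `LyapunovIndirectMethod.lean`, behind Theorem 3.2's DAE tier). [Khalil2002]

AI-produced formalisation (LADDER-GRIDFUSION seat gridfusion-lit-2 g15, 2026-08-28).
-/

noncomputable section

open Finset Filter Set
open scoped Matrix BigOperators Topology

namespace Literature.MathematicalPhysics.PowerSystems

open _root_.Matrix Literature.LinearAlgebra.Matrix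
open Literature.MathematicalPhysics.KineticTheory.HeatConduction (IsHurwitz)

namespace QuadDroopNetwork

variable {n m : ℕ} (W : QuadDroopNetwork n m)

/-- Invertibility of `M` from positive definiteness of `−M` (restated; private in the companions).
[folklore] -/
private theorem isUnit_det_of_posDef_neg'' {ι : Type*} [Fintype ι] [DecidableEq ι] {M : Matrix ι ι ℝ}
    (h : (-M).PosDef) : IsUnit M.det := by
  have h1 : IsUnit (-M).det := (Matrix.isUnit_iff_isUnit_det _).1 h.isUnit
  rw [Matrix.det_neg, isUnit_iff_ne_zero, mul_ne_zero_iff] at h1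
  exact isUnit_iff_ne_zero.2 h1.2

/-! ## §1 The ZIP load model, the residual of the reduced power flow equation, the short-circuit
capacity matrix -/

/-- **The ZIP load model** `Q_l^{ZIP}(E_l) = b_shunt,l E_l² + I_shunt,l E_l + Q_l`: the ZI model augmented
by a constant power demand `Q_l ∈ ℝ`.
[cite: SimpsonporcoDorflerBullo2017, §3.3 (p0011 L61–L66: «the ZIP model `Q_i(E_i) = b_shunt,i E_i² + I_shunt,i E_i + Q_i` … `Q_L^{ZIP}(E_L) = [E_L][b_shunt]E_L + [E_L]I_shunt + Q_L`»)] -/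
def zipLoad (bsh Ish QL : Fin n → ℝ) : Fin n → ℝ → ℝ := fun l e => bsh l * e ^ 2 + Ish l * e + QL l

/-- ZIP = ZI + constant power. [cite: SimpsonporcoDorflerBullo2017, §3.3 (p0011 L61: «augments the ZI model (3.10) with an additional constant power demand»)] -/
theorem zipLoad_apply (bsh Ish QL : Fin n → ℝ) (l : Fin n) (e : ℝ) :
    zipLoad bsh Ish QL l e = ziLoad bsh Ish l e + QL l := rfl

/-- With zero constant-power demand the ZIP model is the ZI model.
[cite: SimpsonporcoDorflerBullo2017, §3.3 (p0011 L61)] -/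
@[simp] theorem zipLoad_zero (bsh Ish : Fin n → ℝ) : zipLoad bsh Ish 0 = ziLoad bsh Ish := by
  funext l e
  simp [zipLoad, ziLoad]

/-- The derivative of the ZIP load model is that of its ZI part: `Q_l' (e) = 2b_l e + I_l`.
[cite: SimpsonporcoDorflerBullo2017, §3.3 eq. (3.9) (`∂Q_L/∂E_L`) with the ZIP model] -/
theorem hasDerivAt_zipLoad (bsh Ish QL : Fin n → ℝ) (l : Fin n) (e : ℝ) :
    HasDerivAt (zipLoad bsh Ish QL l) (2 * bsh l * e + Ish l) e := by
  have h1 := ((hasDerivAt_id e).pow 2).const_mul (bsh l)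
  have h2 := (hasDerivAt_id e).const_mul (Ish l)
  have h3 := (h1.add h2).add_const (QL l)
  refine (h3.congr_of_eventuallyEq (Eventually.of_forall fun e' => ?_)).congr_deriv ?_
  · simp [zipLoad]
  · simp; ring

/-- The ZIP load model is smooth («the reactive power injection `Q_i` is a smooth function of the
supplied voltage `E_i`»). [cite: SimpsonporcoDorflerBullo2017, §2.1 Load Modeling (p0006 L39) and §3.3 ZIP model (p0011 L61–L66)] -/
theorem contDiff_zipLoad (bsh Ish QL : Fin n → ℝ) (l : Fin n) {N : WithTop ℕ∞} :
    ContDiff ℝ N (zipLoad bsh Ish QL l) := by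
  unfold zipLoad
  fun_prop

/-- Its derivative `e ↦ 2b_l e + I_l` is smooth. [cite: SimpsonporcoDorflerBullo2017, §2.1 Load Modeling (p0006 L39: «smooth function of the supplied voltage») with §3.3 (p0011 L61–L66)] -/
theorem contDiff_zipLoad_deriv (bsh Ish : Fin n → ℝ) (l : Fin n) {N : WithTop ℕ∞} :
    ContDiff ℝ N (fun e : ℝ => 2 * bsh l * e + Ish l) := by
  fun_prop

/-- **The residual map of the reduced power flow equation (3.7) with ZIP loads**, as a function of
the pair `(Q_L, E_L)`: `F(Q_L, E_L)_l = Q_l^{ZIP}(E_l) + E_l((B_redE_L)_l − (B_redE_L*)_l)`.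
[cite: SimpsonporcoDorflerBullo2017, §3.2 Theorem 3.1 eq. (3.7) with the ZIP model of §3.3] -/
def zipResidual (bsh Ish : Fin n → ℝ) (p : (Fin n → ℝ) × (Fin n → ℝ)) : Fin n → ℝ :=
  fun l => zipLoad bsh Ish p.1 l (p.2 l) + p.2 l * ((W.Bred *ᵥ p.2) l - W.redSource l)

/-- Zeros of the residual map are exactly the solutions of (3.7) with ZIP loads.
[cite: SimpsonporcoDorflerBullo2017, §3.2 Theorem 3.1 eq. (3.7)] -/
theorem zipResidual_eq_zero_iff (bsh Ish QL EL : Fin n → ℝ) :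
    W.zipResidual bsh Ish (QL, EL) = 0 ↔ W.ReducedPowerFlow (zipLoad bsh Ish QL) EL := by
  simp only [zipResidual, ReducedPowerFlow, funext_iff, Pi.zero_apply]

/-- **(A.1), first form**: `F(Q_L, E_L)_l = Q_l + E_l(((B_red + [b_shunt])E_L)_l − (B_redE_L* − I_shunt)_l)`.
[cite: SimpsonporcoDorflerBullo2017, Appendix A proof of Theorem 3.4, eq. (A.1) (p0019 L26–L30)] -/
theorem zipResidual_apply_eq (bsh Ish QL EL : Fin n → ℝ) (l : Fin n) :
    W.zipResidual bsh Ish (QL, EL) l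
      = QL l + EL l * (((W.Bred + diagonal bsh) *ᵥ EL) l - (W.redSource l - Ish l)) := by
  simp only [zipResidual, zipLoad_apply]
  rw [add_right_comm, ziResidual_eq]
  ring

/-- `(B_red + [b_shunt])E_L^{ZI} = B_redE_L* − I_shunt`. [cite: SimpsonporcoDorflerBullo2017, §3.3 Theorem 3.3 eq. (3.11)] -/
theorem Bsh_mulVec_ziVoltage {bsh Ish : Fin n → ℝ} (hU : IsUnit (W.Bred + diagonal bsh).det) :
    (W.Bred + diagonal bsh) *ᵥ W.ziVoltage bsh Ish = W.redSource - Ish := by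
  rw [ziVoltage, mulVec_mulVec, mul_nonsing_inv _ hU, one_mulVec]

/-- **(A.1)**: with ZIP loads the reduced power flow residual is
`Q_L + [E_L](B_red + [b_shunt])(E_L − E_L^{ZI})`.
[cite: SimpsonporcoDorflerBullo2017, Appendix A proof of Theorem 3.4, eq. (A.1) («`Q_L = −[E_L](B_red + [b_shunt])(E_L − E_L^{ZI})`», p0019 L26–L30)] -/
theorem zipResidual_apply_eq_sub {bsh Ish : Fin n → ℝ} (hU : IsUnit (W.Bred + diagonal bsh).det)
    (QL EL : Fin n → ℝ) (l : Fin n) :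
    W.zipResidual bsh Ish (QL, EL) l
      = QL l + EL l * ((W.Bred + diagonal bsh) *ᵥ (EL - W.ziVoltage bsh Ish)) l := by
  rw [zipResidual_apply_eq, mulVec_sub, W.Bsh_mulVec_ziVoltage hU]
  rfl

/-- The base point: `F(0, E_L^{ZI}) = 0` (Theorem 3.3). [cite: SimpsonporcoDorflerBullo2017, Appendix A proof of Theorem 3.4 («note that `h(0, 0) = 0`», p0019 L44)] -/
theorem zipResidual_base {bsh Ish : Fin n → ℝ} (hU : IsUnit (W.Bred + diagonal bsh).det) :
    W.zipResidual bsh Ish (0, W.ziVoltage bsh Ish) = 0 := by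
  rw [zipResidual_eq_zero_iff, zipLoad_zero]
  exact ziVoltage_reducedPowerFlow hU

/-- **The short-circuit capacity matrix** `Q_sc = [E_L^{ZI}](B_red + [b_shunt])[E_L^{ZI}]`.
[cite: SimpsonporcoDorflerBullo2017, §3.3 Theorem 3.4 eq. (3.14) (p0012 L1–L7)] -/
def Qsc (bsh Ish : Fin n → ℝ) : Matrix (Fin n) (Fin n) ℝ :=
  diagonal (W.ziVoltage bsh Ish) * (W.Bred + diagonal bsh) * diagonal (W.ziVoltage bsh Ish)

/-- Rows of `Q_sc v`: `(Q_sc v)_l = E_l^{ZI}((B_red + [b_shunt])([E^{ZI}]v))_l`. [cite: SimpsonporcoDorflerBullo2017, §3.3 eq. (3.14)] -/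
theorem Qsc_mulVec_apply (bsh Ish v : Fin n → ℝ) (l : Fin n) :
    (W.Qsc bsh Ish *ᵥ v) l
      = W.ziVoltage bsh Ish l * ((W.Bred + diagonal bsh) *ᵥ fun j => W.ziVoltage bsh Ish j * v j) l := by
  have hd : diagonal (W.ziVoltage bsh Ish) *ᵥ v = fun j => W.ziVoltage bsh Ish j * v j :=
    funext fun j => mulVec_diagonal _ _ j
  rw [Qsc, ← mulVec_mulVec, ← mulVec_mulVec, mulVec_diagonal, hd]

/-- `Q_sc = J_red(E_L^{ZI})[E_L^{ZI}]`. [cite: SimpsonporcoDorflerBullo2017, §3.3 eqs. (3.13)–(3.14)] -/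
theorem Qsc_eq_jacRed_mul {bsh Ish : Fin n → ℝ} (hU : IsUnit (W.Bred + diagonal bsh).det) :
    W.Qsc bsh Ish
      = W.jacRed (fun l => 2 * bsh l * W.ziVoltage bsh Ish l + Ish l) (W.ziVoltage bsh Ish)
          * diagonal (W.ziVoltage bsh Ish) := by
  rw [jacRed_ziVoltage hU, Qsc]

/-- `Q_sc` is symmetric when `B` is. [cite: SimpsonporcoDorflerBullo2017, §3.3 eq. (3.14)] -/
theorem Qsc_transpose {bsh Ish : Fin n → ℝ} (hB : W.B.IsSymm) : (W.Qsc bsh Ish)ᵀ = W.Qsc bsh Ish := by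
  rw [Qsc, transpose_mul, transpose_mul, diagonal_transpose, transpose_add, diagonal_transpose,
    Bred_transpose hB, Matrix.mul_assoc]

/-- `Q_sc` is invertible when `B_red + [b_shunt]` is and `E_L^{ZI}` has no zero entry.
[cite: SimpsonporcoDorflerBullo2017, Appendix A proof of Theorem 3.4 («`Q_sc` … is full rank», p0019 L44)] -/
theorem isUnit_Qsc_det {bsh Ish : Fin n → ℝ} (hU : IsUnit (W.Bred + diagonal bsh).det)
    (hE : ∀ l, W.ziVoltage bsh Ish l ≠ 0) : IsUnit (W.Qsc bsh Ish).det := by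
  have hD : IsUnit (diagonal (W.ziVoltage bsh Ish)).det := by
    rw [det_diagonal, isUnit_iff_ne_zero]
    exact Finset.prod_ne_zero_iff.2 fun l _ => hE l
  rw [Qsc, det_mul, det_mul]
  exact (hD.mul hU).mul hD

/-- `−Q_sc ≻ 0` under Theorem 3.3 (i) (congruence by the positive diagonal `[E_L^{ZI}]`).
[cite: SimpsonporcoDorflerBullo2017, §3.3 Theorem 3.3 (i) and eq. (3.14)] -/
theorem posDef_neg_Qsc {bsh Ish : Fin n → ℝ} (hA : (-(W.Bred + diagonal bsh)).PosDef)
    (hE : ∀ l, W.ziVoltage bsh Ish l ≠ 0) : (-(W.Qsc bsh Ish)).PosDef := by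
  have hform : -(W.Qsc bsh Ish)
      = (diagonal (W.ziVoltage bsh Ish))ᴴ * (-(W.Bred + diagonal bsh)) * diagonal (W.ziVoltage bsh Ish) := by
    rw [Qsc, conjTranspose_eq_transpose_of_trivial, diagonal_transpose, Matrix.mul_neg, Matrix.neg_mul]
  rw [hform]
  refine hA.conjTranspose_mul_mul_same ?_
  intro v w hvw
  funext j
  have := congrFun hvw j
  simp only [mulVec_diagonal] at this
  exact mul_left_cancel₀ (hE j) this

/-! ## §2 The implicit function theorem at `(Q_L, E_L) = (0, E_L^{ZI})` -/

/-- The linear functional `h ↦ (B_red h)_l`. [folklore] -/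
private def bredRow (l : Fin n) : (Fin n → ℝ) →L[ℝ] ℝ :=
  (ContinuousLinearMap.proj l).comp (LinearMap.toContinuousLinearMap (Matrix.toLin' W.Bred))

/-- Unfolding `bredRow`. [folklore] -/
private theorem bredRow_apply (l : Fin n) (h : Fin n → ℝ) : W.bredRow l h = (W.Bred *ᵥ h) l := by
  simp [bredRow, Matrix.toLin'_apply]

/-- The residual map is smooth (polynomial) jointly in `(Q_L, E_L)`.
[cite: SimpsonporcoDorflerBullo2017, Appendix A proof of Theorem 3.4 (smoothness needed for the implicit function theorem, p0019 L44–L48)] -/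
theorem contDiff_zipResidual (bsh Ish : Fin n → ℝ) {N : WithTop ℕ∞} :
    ContDiff ℝ N (W.zipResidual bsh Ish) := by
  rw [contDiff_pi]
  intro l
  have h1 : ContDiff ℝ N (fun p : (Fin n → ℝ) × (Fin n → ℝ) => p.1 l) :=
    (contDiff_apply ℝ ℝ l).comp contDiff_fst
  have h2 : ContDiff ℝ N (fun p : (Fin n → ℝ) × (Fin n → ℝ) => p.2 l) :=
    (contDiff_apply ℝ ℝ l).comp contDiff_snd
  have h3 : ContDiff ℝ N (fun p : (Fin n → ℝ) × (Fin n → ℝ) => (W.Bred *ᵥ p.2) l) := by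
    have := ((W.bredRow l).contDiff (n := N)).comp (contDiff_snd (E := Fin n → ℝ) (F := Fin n → ℝ))
    simpa [Function.comp_def, bredRow_apply] using this
  have h4 : ContDiff ℝ N (fun p : (Fin n → ℝ) × (Fin n → ℝ) => zipLoad bsh Ish p.1 l (p.2 l)) := by
    unfold zipLoad
    exact ((contDiff_const.mul (h2.pow 2)).add (contDiff_const.mul h2)).add h1
  exact h4.add (h2.mul (h3.sub contDiff_const))

/-- Rows of `J_red h`: `(J_red h)_l = Q_l' h_l + E_l(B_red h)_l + ((B_redE_L)_l − (B_redE_L*)_l)h_l`.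
[cite: SimpsonporcoDorflerBullo2017, §3.2 Theorem 3.2 eq. (3.9)] -/
theorem jacRed_mulVec_apply (dQ EL h : Fin n → ℝ) (l : Fin n) :
    (W.jacRed dQ EL *ᵥ h) l
      = dQ l * h l + EL l * (W.Bred *ᵥ h) l + ((W.Bred *ᵥ EL) l - W.redSource l) * h l := by
  simp only [jacRed, add_mulVec, Pi.add_apply, Pi.sub_apply, ← mulVec_mulVec, mulVec_diagonal]

/-- **The partial derivative of the residual in `E_L` is the reduced Jacobian (3.9)** (ZIP load
derivative `Q_l' = 2b_lE_l + I_l`): `∂F/∂E_L(Q_L, E_L) = J_red(E_L)`.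
[cite: SimpsonporcoDorflerBullo2017, §3.2 eq. (3.9) («the Jacobian of the reduced power flow equation») and Appendix A («`∂h/∂ε(0,0) = Q_sc`», p0019 L44)] -/
theorem hasFDerivAt_zipResidual_inr (bsh Ish QL EL : Fin n → ℝ) :
    HasFDerivAt (fun EL' : Fin n → ℝ => W.zipResidual bsh Ish (QL, EL'))
      (LinearMap.toContinuousLinearMap
        (Matrix.toLin' (W.jacRed (fun l => 2 * bsh l * EL l + Ish l) EL))) EL := by
  set L : (Fin n → ℝ) →L[ℝ] (Fin n → ℝ) := LinearMap.toContinuousLinearMap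
    (Matrix.toLin' (W.jacRed (fun l => 2 * bsh l * EL l + Ish l) EL)) with hL
  have hproj : ∀ l : Fin n, HasFDerivAt (fun E' : Fin n → ℝ => E' l)
      (ContinuousLinearMap.proj l : (Fin n → ℝ) →L[ℝ] ℝ) EL := fun l => hasFDerivAt_apply l EL
  have hLk : ∀ (l) (h : Fin n → ℝ),
      ((ContinuousLinearMap.proj l : (Fin n → ℝ) →L[ℝ] ℝ).comp L) h
        = (W.jacRed (fun l => 2 * bsh l * EL l + Ish l) EL *ᵥ h) l := by
    intro l h
    simp [hL, Matrix.toLin'_apply]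
  have hrow : ∀ l : Fin n, HasFDerivAt (fun E' : Fin n → ℝ => (W.Bred *ᵥ E') l - W.redSource l)
      (W.bredRow l) EL := fun l =>
    ((W.bredRow l).hasFDerivAt.congr_of_eventuallyEq
      (Eventually.of_forall fun E' => (W.bredRow_apply l E').symm)).sub_const _
  rw [hasFDerivAt_pi']
  intro l
  have hQ' := (hasDerivAt_zipLoad bsh Ish QL l (EL l)).comp_hasFDerivAt EL (hproj l)
  have hsum := hQ'.add ((hproj l).mul (hrow l))
  refine (hsum.congr_of_eventuallyEq (Eventually.of_forall fun E' => rfl)).congr_fderiv ?_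
  ext h
  rw [hLk, jacRed_mulVec_apply]
  simp only [_root_.add_apply, _root_.smul_apply, ContinuousLinearMap.proj_apply, smul_eq_mul,
    bredRow_apply]
  ring

/-- The partial derivative of the residual in `Q_L` is the identity: `F(Q_L, E_L) = Q_L + F(0, E_L)`.
[cite: SimpsonporcoDorflerBullo2017, §3.3 (p0011 L61–L66: the constant power demand enters additively)] -/
theorem zipResidual_add_left (bsh Ish QL EL : Fin n → ℝ) :
    W.zipResidual bsh Ish (QL, EL) = QL + W.zipResidual bsh Ish (0, EL) := by
  funext l
  simp only [zipResidual, zipLoad, Pi.add_apply, Pi.zero_apply]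
  ring

/-- `E_L ↦ (Q_L, E_L)` has derivative `inr`. [folklore] -/
private theorem hasFDerivAt_pair_right (QL EL : Fin n → ℝ) :
    HasFDerivAt (fun EL' : Fin n → ℝ => (QL, EL'))
      (ContinuousLinearMap.inr ℝ (Fin n → ℝ) (Fin n → ℝ)) EL :=
  ((hasFDerivAt_const QL EL).prodMk (hasFDerivAt_id EL)).congr_fderiv
    (ContinuousLinearMap.ext fun v => Prod.ext (by simp) (by simp))

/-- `Q_L ↦ (Q_L, E_L)` has derivative `inl`. [folklore] -/
private theorem hasFDerivAt_pair_left (QL EL : Fin n → ℝ) :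
    HasFDerivAt (fun QL' : Fin n → ℝ => (QL', EL))
      (ContinuousLinearMap.inl ℝ (Fin n → ℝ) (Fin n → ℝ)) QL :=
  ((hasFDerivAt_id QL).prodMk (hasFDerivAt_const EL QL)).congr_fderiv
    (ContinuousLinearMap.ext fun v => Prod.ext (by simp) (by simp))

/-- The residual map is strictly differentiable at the base point (it is `C¹`).
[cite: SimpsonporcoDorflerBullo2017, Appendix A proof of Theorem 3.4 (p0019 L44–L48)] -/
theorem hasStrictFDerivAt_zipResidual (bsh Ish : Fin n → ℝ) (p : (Fin n → ℝ) × (Fin n → ℝ)) :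
    HasStrictFDerivAt (W.zipResidual bsh Ish) (fderiv ℝ (W.zipResidual bsh Ish) p) p :=
  ((W.contDiff_zipResidual bsh Ish (N := 1)).contDiffAt).hasStrictFDerivAt one_ne_zero

/-- The `E_L`-partial of the total derivative at `(Q_L, E_L)` is the reduced Jacobian.
[cite: SimpsonporcoDorflerBullo2017, §3.2 eq. (3.9); Appendix A (p0019 L44)] -/
theorem fderiv_zipResidual_comp_inr (bsh Ish QL EL : Fin n → ℝ) :
    (fderiv ℝ (W.zipResidual bsh Ish) (QL, EL)).comp
        (ContinuousLinearMap.inr ℝ (Fin n → ℝ) (Fin n → ℝ))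
      = LinearMap.toContinuousLinearMap
          (Matrix.toLin' (W.jacRed (fun l => 2 * bsh l * EL l + Ish l) EL)) := by
  have dfu := (W.hasStrictFDerivAt_zipResidual bsh Ish (QL, EL)).hasFDerivAt
  have hcomp := dfu.comp EL (hasFDerivAt_pair_right QL EL)
  have hcomp' : HasFDerivAt (fun EL' : Fin n → ℝ => W.zipResidual bsh Ish (QL, EL'))
      ((fderiv ℝ (W.zipResidual bsh Ish) (QL, EL)).comp
        (ContinuousLinearMap.inr ℝ (Fin n → ℝ) (Fin n → ℝ))) EL := hcomp
  exact hcomp'.unique (W.hasFDerivAt_zipResidual_inr bsh Ish QL EL)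

/-- The `Q_L`-partial of the total derivative is the identity.
[cite: SimpsonporcoDorflerBullo2017, §3.3 (p0011 L61–L66)] -/
theorem fderiv_zipResidual_comp_inl (bsh Ish QL EL : Fin n → ℝ) :
    (fderiv ℝ (W.zipResidual bsh Ish) (QL, EL)).comp
        (ContinuousLinearMap.inl ℝ (Fin n → ℝ) (Fin n → ℝ))
      = ContinuousLinearMap.id ℝ (Fin n → ℝ) := by
  have dfu := (W.hasStrictFDerivAt_zipResidual bsh Ish (QL, EL)).hasFDerivAt
  have hcomp := dfu.comp QL (hasFDerivAt_pair_left QL EL)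
  have hcomp' : HasFDerivAt (fun QL' : Fin n → ℝ => W.zipResidual bsh Ish (QL', EL))
      ((fderiv ℝ (W.zipResidual bsh Ish) (QL, EL)).comp
        (ContinuousLinearMap.inl ℝ (Fin n → ℝ) (Fin n → ℝ))) QL := hcomp
  have hid : HasFDerivAt (fun QL' : Fin n → ℝ => W.zipResidual bsh Ish (QL', EL))
      (ContinuousLinearMap.id ℝ (Fin n → ℝ)) QL := by
    have h : HasFDerivAt (fun QL' : Fin n → ℝ => QL' + W.zipResidual bsh Ish (0, EL))
        (ContinuousLinearMap.id ℝ (Fin n → ℝ)) QL := (hasFDerivAt_id QL).add_const _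
    refine h.congr_of_eventuallyEq (Eventually.of_forall fun QL' => ?_)
    exact W.zipResidual_add_left bsh Ish QL' EL
  exact hcomp'.unique hid

/-- **`∂F/∂E_L(0, E_L^{ZI}) = J_red(E_L^{ZI}) = [E_L^{ZI}](B_red + [b_shunt])` is invertible** when
`B_red + [b_shunt]` is invertible and `E_L^{ZI}` has no zero entry («`∂h/∂ε(0,0) = Q_sc`, which is full
rank»). [cite: SimpsonporcoDorflerBullo2017, Appendix A proof of Theorem 3.4 (p0019 L44–L45)] -/
theorem isInvertible_fderiv_zipResidual_inr {bsh Ish : Fin n → ℝ}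
    (hU : IsUnit (W.Bred + diagonal bsh).det) (hE : ∀ l, W.ziVoltage bsh Ish l ≠ 0) :
    ((fderiv ℝ (W.zipResidual bsh Ish) (0, W.ziVoltage bsh Ish)).comp
        (ContinuousLinearMap.inr ℝ (Fin n → ℝ) (Fin n → ℝ))).IsInvertible := by
  rw [fderiv_zipResidual_comp_inr, jacRed_ziVoltage hU]
  set J : Matrix (Fin n) (Fin n) ℝ := diagonal (W.ziVoltage bsh Ish) * (W.Bred + diagonal bsh) with hJ
  have hJU : IsUnit J.det := by
    have hD : IsUnit (diagonal (W.ziVoltage bsh Ish)).det := by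
      rw [det_diagonal, isUnit_iff_ne_zero]
      exact Finset.prod_ne_zero_iff.2 fun l _ => hE l
    rw [hJ, det_mul]
    exact hD.mul hU
  set T : (Fin n → ℝ) →L[ℝ] (Fin n → ℝ) := LinearMap.toContinuousLinearMap (Matrix.toLin' J) with hT
  have hTapp : ∀ v, T v = J *ᵥ v := fun v => by simp [hT, Matrix.toLin'_apply]
  have hinj : Function.Injective T.toLinearMap := by
    intro a b hab
    have hab' : J *ᵥ a = J *ᵥ b := by
      have h1 : T a = T b := hab
      rwa [hTapp, hTapp] at h1
    calc a = J⁻¹ *ᵥ (J *ᵥ a) := by rw [mulVec_mulVec, nonsing_inv_mul _ hJU, one_mulVec]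
      _ = b := by rw [hab', mulVec_mulVec, nonsing_inv_mul _ hJU, one_mulVec]
  have hsurj : Function.Surjective T.toLinearMap := LinearMap.injective_iff_surjective.1 hinj
  exact ⟨ContinuousLinearEquiv.ofBijective T (LinearMap.ker_eq_bot.2 hinj)
    (LinearMap.range_eq_top.2 hsurj), ContinuousLinearEquiv.coe_ofBijective _ _ _⟩

/-- **The high-voltage solution map `Q_L ↦ E_L^{ZIP}(Q_L)`**: the implicit function of the reduced
power flow equation with ZIP loads at `(0, E_L^{ZI})` when the implicit function theorem applies
(`∂F/∂E_L(0, E_L^{ZI})` invertible), and the constant `E_L^{ZI}` otherwise (a harmless default: every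
theorem below assumes the invertibility hypotheses).
[cite: SimpsonporcoDorflerBullo2017, §3.3 Theorem 3.4 eq. (3.15) and Appendix A («a continuously differentiable function `H : U₀ → V₀` such that `h(H(q_L), q_L) = 0`», p0019 L45–L48)] -/
def zipVoltage (bsh Ish : Fin n → ℝ) : (Fin n → ℝ) → (Fin n → ℝ) := by
  classical
  exact if h : ((fderiv ℝ (W.zipResidual bsh Ish) (0, W.ziVoltage bsh Ish)).comp
      (ContinuousLinearMap.inr ℝ (Fin n → ℝ) (Fin n → ℝ))).IsInvertible then
    (W.hasStrictFDerivAt_zipResidual bsh Ish (0, W.ziVoltage bsh Ish)).implicitFunctionOfProdDomain h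
  else fun _ => W.ziVoltage bsh Ish

/-- Under the invertibility hypotheses `zipVoltage` IS Mathlib's implicit function of the reduced power
flow residual at `(0, E_L^{ZI})`. [cite: SimpsonporcoDorflerBullo2017, Appendix A proof of Theorem 3.4 («a continuously differentiable function `H : U₀ → V₀` such that `h(H(q_L), q_L) = 0`», p0019 L45–L48)] -/
theorem zipVoltage_eq {bsh Ish : Fin n → ℝ} (hU : IsUnit (W.Bred + diagonal bsh).det)
    (hE : ∀ l, W.ziVoltage bsh Ish l ≠ 0) :
    W.zipVoltage bsh Ish
      = (W.hasStrictFDerivAt_zipResidual bsh Ish (0, W.ziVoltage bsh Ish)).implicitFunctionOfProdDomain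
          (W.isInvertible_fderiv_zipResidual_inr hU hE) := by
  classical
  unfold zipVoltage
  rw [dif_pos (W.isInvertible_fderiv_zipResidual_inr hU hE)]

/-- **Theorem 3.4, existence and local uniqueness (implicit function theorem).**  If
`B_red + [b_shunt]` is invertible and `E_L^{ZI}` has no zero entry (both hold under Theorem 3.3's
(i)–(ii)), then the solution map `E_L^{ZIP} = zipVoltage` satisfies: `E_L^{ZIP}(0) = E_L^{ZI}`; it is
`C^N` at `Q_L = 0` for every `N` («continuously differentiable»); for all sufficiently small `Q_L` it
solves the reduced power flow equation (3.7) with ZIP loads; and for `(Q_L, E_L)` near `(0, E_L^{ZI})`,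
`E_L` solves (3.7) with ZIP loads IFF `E_L = E_L^{ZIP}(Q_L)` (local uniqueness of the high-voltage
solution).  [cite: SimpsonporcoDorflerBullo2017, §3.3 Theorem 3.4 («If `‖Q_L‖` is sufficiently small, then there exists a unique high-voltage solution `E_L^{ZIP}`») and Appendix A (p0019 L44–L48: «It follows from the Implicit Function Theorem that there exist open sets `U₀, V₀ ⊂ ℝ^n` … and a continuously differentiable function `H : U₀ → V₀` such that `h(H(q_L), q_L) = 0` for all `q_L ∈ U₀`»)] -/
theorem theorem_3_4_implicitFunction {bsh Ish : Fin n → ℝ} (hU : IsUnit (W.Bred + diagonal bsh).det)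
    (hE : ∀ l, W.ziVoltage bsh Ish l ≠ 0) {N : WithTop ℕ∞} :
    W.zipVoltage bsh Ish 0 = W.ziVoltage bsh Ish ∧
      ContDiffAt ℝ N (W.zipVoltage bsh Ish) 0 ∧
      (∀ᶠ QL in 𝓝 (0 : Fin n → ℝ), W.ReducedPowerFlow (zipLoad bsh Ish QL) (W.zipVoltage bsh Ish QL)) ∧
      ∀ᶠ p in 𝓝 ((0 : Fin n → ℝ), W.ziVoltage bsh Ish),
        W.ReducedPowerFlow (zipLoad bsh Ish p.1) p.2 ↔ W.zipVoltage bsh Ish p.1 = p.2 := by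
  set E := W.ziVoltage bsh Ish with hEdef
  set u₀ : (Fin n → ℝ) × (Fin n → ℝ) := (0, E) with hu₀
  have dfu := W.hasStrictFDerivAt_zipResidual bsh Ish u₀
  have hinv := W.isInvertible_fderiv_zipResidual_inr hU hE
  have hf0 : W.zipResidual bsh Ish u₀ = 0 := W.zipResidual_base hU
  have hΦ : W.zipVoltage bsh Ish = dfu.implicitFunctionOfProdDomain hinv := W.zipVoltage_eq hU hE
  have hiff := dfu.eventually_apply_eq_iff_implicitFunctionOfProdDomain hinv
  have hsol := dfu.eventually_apply_implicitFunctionOfProdDomain hinv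
  have hu₀1 : u₀.1 = (0 : Fin n → ℝ) := rfl
  rw [hu₀1] at hsol
  have hΦ0 : W.zipVoltage bsh Ish 0 = E := by
    rw [hΦ]; exact (hiff.self_of_nhds).1 rfl
  refine ⟨hΦ0, ?_, ?_, ?_⟩
  · -- smoothness of the implicit function (Mathlib `ContDiffAt.contDiffAt_implicitFunction`)
    have hcd : ∀ {N' : WithTop ℕ∞}, N' ≠ 0 → ContDiffAt ℝ N' (W.zipVoltage bsh Ish) 0 := by
      intro N' hN0
      have hN : ContDiffAt ℝ N' (W.zipResidual bsh Ish) u₀ :=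
        (W.contDiff_zipResidual bsh Ish).contDiffAt
      have key := hN.contDiffAt_implicitFunction hN0 hinv
      rw [ContDiffAt.implicitFunction_def] at key
      rw [hΦ]
      exact key
    rcases eq_or_ne N 0 with hN0 | hN0
    · rw [hN0]
      exact (hcd one_ne_zero).of_le zero_le_one
    · exact hcd hN0
  · filter_upwards [hsol] with QL hQL
    rw [hf0, ← hΦ, zipResidual_eq_zero_iff] at hQL
    exact hQL
  · filter_upwards [hiff] with ⟨QL, EL⟩ hp
    rw [hf0, ← hΦ] at hp
    rw [← hp]
    exact (W.zipResidual_eq_zero_iff bsh Ish QL EL).symm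

/-- Continuity of the solution map at `0`: `E_L^{ZIP}(Q_L) → E_L^{ZI}` as `Q_L → 0`.
[cite: SimpsonporcoDorflerBullo2017, §3.3 after Theorem 3.4 («As `‖Q_sc⁻¹Q_L‖ → 0` … `E_L^{ZIP} → E_L^{ZI}`», p0012 L18)] -/
theorem tendsto_zipVoltage {bsh Ish : Fin n → ℝ} (hU : IsUnit (W.Bred + diagonal bsh).det)
    (hE : ∀ l, W.ziVoltage bsh Ish l ≠ 0) :
    Tendsto (W.zipVoltage bsh Ish) (𝓝 0) (𝓝 (W.ziVoltage bsh Ish)) := by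
  obtain ⟨h0, h1, -, -⟩ := W.theorem_3_4_implicitFunction hU hE (N := 0)
  have := (h1.continuousAt).tendsto
  rwa [h0] at this

/-! ## §3 The coordinates `E_L = [E_L^{ZI}](𝟙 − Q_sc⁻¹Q_L + ε)` and the quadratic bound on `ε` -/

/-- **(A.3): the reduced power flow equation in the coordinates `(ε, q_L)`.**  For `E_L^{ZI}` with
nonzero entries and `B_red + [b_shunt]` invertible,
`F(Q_sc q, [E_L^{ZI}](𝟙 − q + ε)) = Q_sc ε + [q − ε]Q_sc(q − ε) = h(ε, q)`.
[cite: SimpsonporcoDorflerBullo2017, Appendix A proof of Theorem 3.4, eqs. (A.2)–(A.3) («Substituting this into the power flow (A.1), some basic algebra leads to `h(ε, q_L) ≜ Q_sc ε + [q_L − ε]Q_sc(q_L − ε) = 0`», p0019 L32–L42)] -/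
theorem zipResidual_coordinates {bsh Ish : Fin n → ℝ} (hU : IsUnit (W.Bred + diagonal bsh).det)
    (q ε : Fin n → ℝ) :
    W.zipResidual bsh Ish (W.Qsc bsh Ish *ᵥ q, fun l => W.ziVoltage bsh Ish l * (1 - q l + ε l))
      = W.Qsc bsh Ish *ᵥ ε + fun l => (q l - ε l) * (W.Qsc bsh Ish *ᵥ (q - ε)) l := by
  set E := W.ziVoltage bsh Ish with hEdef
  funext l
  rw [W.zipResidual_apply_eq_sub hU, Pi.add_apply]
  have hsub : ((fun l => E l * (1 - q l + ε l)) - E) = fun j => E j * (ε - q) j := by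
    funext j
    simp only [Pi.sub_apply]
    ring
  rw [hsub]
  have h1 : E l * ((W.Bred + diagonal bsh) *ᵥ fun j => E j * (ε - q) j) l
      = (W.Qsc bsh Ish *ᵥ (ε - q)) l := by rw [Qsc_mulVec_apply]
  have h2 : W.Qsc bsh Ish *ᵥ (ε - q) = W.Qsc bsh Ish *ᵥ ε - W.Qsc bsh Ish *ᵥ q := mulVec_sub _ _ _
  have h3 : W.Qsc bsh Ish *ᵥ (q - ε) = W.Qsc bsh Ish *ᵥ q - W.Qsc bsh Ish *ᵥ ε := mulVec_sub _ _ _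
  calc (W.Qsc bsh Ish *ᵥ q) l + E l * (1 - q l + ε l)
          * ((W.Bred + diagonal bsh) *ᵥ fun j => E j * (ε - q) j) l
        = (W.Qsc bsh Ish *ᵥ q) l + (1 - q l + ε l) * (W.Qsc bsh Ish *ᵥ (ε - q)) l := by
          rw [← h1]; ring
    _ = (W.Qsc bsh Ish *ᵥ ε) l + (q l - ε l) * (W.Qsc bsh Ish *ᵥ (q - ε)) l := by
          rw [h2, h3, Pi.sub_apply, Pi.sub_apply]; ring

/-- **The error coordinate** `ε = [E_L^{ZI}]⁻¹E_L − 𝟙 + Q_sc⁻¹Q_L` of a load-voltage vector `E_L`, so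
that `E_L = [E_L^{ZI}](𝟙 − Q_sc⁻¹Q_L + ε)`.
[cite: SimpsonporcoDorflerBullo2017, §3.3 Theorem 3.4 eq. (3.15) and Appendix A eq. (A.2) («the invertible change of coordinates `E_L = [E_L^{ZI}](𝟙 − Q_sc⁻¹Q_L + ε)`», p0019 L32–L36)] -/
def zipError (bsh Ish QL EL : Fin n → ℝ) : Fin n → ℝ :=
  fun l => EL l / W.ziVoltage bsh Ish l - 1 + ((W.Qsc bsh Ish)⁻¹ *ᵥ QL) l

/-- **(3.15) / (A.2)**: `E_L = [E_L^{ZI}](𝟙 − Q_sc⁻¹Q_L + ε)` with `ε = zipError`.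
[cite: SimpsonporcoDorflerBullo2017, §3.3 Theorem 3.4 eq. (3.15); Appendix A eq. (A.2)] -/
theorem eq_coordinates_zipError {bsh Ish : Fin n → ℝ} (hE : ∀ l, W.ziVoltage bsh Ish l ≠ 0)
    (QL EL : Fin n → ℝ) :
    EL = fun l => W.ziVoltage bsh Ish l
      * (1 - ((W.Qsc bsh Ish)⁻¹ *ᵥ QL) l + W.zipError bsh Ish QL EL l) := by
  funext l
  simp only [zipError]
  field_simp [hE l]
  ring

/-- **(A.3) along solutions**: if `E_L` solves (3.7) with ZIP loads `Q_L`, then with `q = Q_sc⁻¹Q_L`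
and `ε = zipError`, `Q_sc ε = −[q − ε]Q_sc(q − ε)`.
[cite: SimpsonporcoDorflerBullo2017, Appendix A proof of Theorem 3.4, eq. (A.3) and (A.4) («rearrange (A.3)», p0019 L38–L52)] -/
theorem Qsc_mulVec_zipError {bsh Ish : Fin n → ℝ} (hU : IsUnit (W.Bred + diagonal bsh).det)
    (hE : ∀ l, W.ziVoltage bsh Ish l ≠ 0) {QL EL : Fin n → ℝ}
    (hR : W.ReducedPowerFlow (zipLoad bsh Ish QL) EL) :
    W.Qsc bsh Ish *ᵥ W.zipError bsh Ish QL EL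
      = -fun l => (((W.Qsc bsh Ish)⁻¹ *ᵥ QL) l - W.zipError bsh Ish QL EL l)
          * (W.Qsc bsh Ish *ᵥ (((W.Qsc bsh Ish)⁻¹ *ᵥ QL) - W.zipError bsh Ish QL EL)) l := by
  set q := (W.Qsc bsh Ish)⁻¹ *ᵥ QL with hq
  set ε := W.zipError bsh Ish QL EL with hε
  have hQsc : IsUnit (W.Qsc bsh Ish).det := W.isUnit_Qsc_det hU hE
  have hQL : W.Qsc bsh Ish *ᵥ q = QL := by
    rw [hq, mulVec_mulVec, mul_nonsing_inv _ hQsc, one_mulVec]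
  have hEL : EL = fun l => W.ziVoltage bsh Ish l * (1 - q l + ε l) :=
    W.eq_coordinates_zipError hE QL EL
  have hres : W.zipResidual bsh Ish (W.Qsc bsh Ish *ᵥ q, fun l => W.ziVoltage bsh Ish l * (1 - q l + ε l))
      = 0 := by
    rw [hQL, ← hEL, zipResidual_eq_zero_iff]
    exact hR
  rw [zipResidual_coordinates _ hU] at hres
  exact eq_neg_of_add_eq_zero_left hres

/-- The operator `v ↦ Av` on `(ℝ^n, ‖·‖_∞)` as a continuous linear map. [folklore] -/
private def mulVecCLM (A : Matrix (Fin n) (Fin n) ℝ) : (Fin n → ℝ) →L[ℝ] (Fin n → ℝ) :=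
  LinearMap.toContinuousLinearMap (Matrix.toLin' A)

/-- Unfolding `mulVecCLM`. [folklore] -/
private theorem mulVecCLM_apply (A : Matrix (Fin n) (Fin n) ℝ) (v : Fin n → ℝ) :
    mulVecCLM A v = A *ᵥ v := by
  simp [mulVecCLM, Matrix.toLin'_apply]

/-- `‖Av‖ ≤ ‖A‖‖v‖` (operator norm). [folklore] -/
private theorem norm_mulVec_le (A : Matrix (Fin n) (Fin n) ℝ) (v : Fin n → ℝ) :
    ‖A *ᵥ v‖ ≤ ‖mulVecCLM A‖ * ‖v‖ := by
  rw [← mulVecCLM_apply]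
  exact (mulVecCLM A).le_opNorm v

/-- `‖[v]Av‖_∞ ≤ ‖A‖‖v‖²` («a series of elementary inequalities shows that the right-hand side … is
upper bounded by `β‖q_L − ε‖²`»). [cite: SimpsonporcoDorflerBullo2017, Appendix A proof of Theorem 3.4 (p0019 L52–L54)] -/
private theorem norm_hadamard_mulVec_le (A : Matrix (Fin n) (Fin n) ℝ) (v : Fin n → ℝ) :
    ‖fun l => v l * (A *ᵥ v) l‖ ≤ ‖mulVecCLM A‖ * ‖v‖ ^ 2 := by
  have hnn : 0 ≤ ‖mulVecCLM A‖ * ‖v‖ ^ 2 := by positivity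
  refine (pi_norm_le_iff_of_nonneg hnn).2 fun l => ?_
  rw [norm_mul]
  calc ‖v l‖ * ‖(A *ᵥ v) l‖ ≤ ‖v‖ * ‖A *ᵥ v‖ :=
        mul_le_mul (norm_le_pi_norm v l) (norm_le_pi_norm (A *ᵥ v) l) (norm_nonneg _) (norm_nonneg _)
    _ ≤ ‖v‖ * (‖mulVecCLM A‖ * ‖v‖) :=
        mul_le_mul_of_nonneg_left (norm_mulVec_le A v) (norm_nonneg _)
    _ = ‖mulVecCLM A‖ * ‖v‖ ^ 2 := by ring

/-- **(A.4)–(A.5): `‖ε‖ ≤ κ‖q_L − ε‖²`** along solutions, with `κ = ‖Q_sc⁻¹‖‖Q_sc‖` (operator norms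
on `(ℝ^n, ‖·‖_∞)`; the print's `β/α`).
[cite: SimpsonporcoDorflerBullo2017, Appendix A proof of Theorem 3.4, eqs. (A.4)–(A.5) («the left-hand side of (A.4) is lower-bounded by `α‖ε‖` … the right-hand side … upper bounded by `β‖q_L − ε‖²`», p0019 L50–L58)] -/
theorem norm_zipError_le_mul_sq {bsh Ish : Fin n → ℝ} (hU : IsUnit (W.Bred + diagonal bsh).det)
    (hE : ∀ l, W.ziVoltage bsh Ish l ≠ 0) {QL EL : Fin n → ℝ}
    (hR : W.ReducedPowerFlow (zipLoad bsh Ish QL) EL) :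
    ‖W.zipError bsh Ish QL EL‖
      ≤ (‖mulVecCLM (W.Qsc bsh Ish)⁻¹‖ * ‖mulVecCLM (W.Qsc bsh Ish)‖)
          * ‖((W.Qsc bsh Ish)⁻¹ *ᵥ QL) - W.zipError bsh Ish QL EL‖ ^ 2 := by
  set q := (W.Qsc bsh Ish)⁻¹ *ᵥ QL with hq
  set ε := W.zipError bsh Ish QL EL with hε
  have hQsc : IsUnit (W.Qsc bsh Ish).det := W.isUnit_Qsc_det hU hE
  have hid : ε = (W.Qsc bsh Ish)⁻¹ *ᵥ (W.Qsc bsh Ish *ᵥ ε) := by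
    rw [mulVec_mulVec, nonsing_inv_mul _ hQsc, one_mulVec]
  have hA3 := W.Qsc_mulVec_zipError hU hE hR
  rw [← hq, ← hε] at hA3
  calc ‖ε‖ = ‖(W.Qsc bsh Ish)⁻¹ *ᵥ (W.Qsc bsh Ish *ᵥ ε)‖ := by rw [← hid]
    _ ≤ ‖mulVecCLM (W.Qsc bsh Ish)⁻¹‖ * ‖W.Qsc bsh Ish *ᵥ ε‖ := norm_mulVec_le _ _
    _ = ‖mulVecCLM (W.Qsc bsh Ish)⁻¹‖ * ‖fun l => (q l - ε l) * (W.Qsc bsh Ish *ᵥ (q - ε)) l‖ := by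
        rw [hA3, norm_neg]
    _ ≤ ‖mulVecCLM (W.Qsc bsh Ish)⁻¹‖ * (‖mulVecCLM (W.Qsc bsh Ish)‖ * ‖q - ε‖ ^ 2) := by
        refine mul_le_mul_of_nonneg_left ?_ (norm_nonneg _)
        have := norm_hadamard_mulVec_le (W.Qsc bsh Ish) (q - ε)
        simpa only [Pi.sub_apply] using this
    _ = (‖mulVecCLM (W.Qsc bsh Ish)⁻¹‖ * ‖mulVecCLM (W.Qsc bsh Ish)‖) * ‖q - ε‖ ^ 2 := by ring

/-- **(A.5) ⇒ (A.6), the elementary step**: `0 ≤ e ≤ κ(a + e)²` with `κ(a + e) ≤ ½` forces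
`e ≤ 4κa²` («some simple algebra shows that inequality (A.5) further implies … `‖ε‖ ≤ 4(β/α)‖q_L‖²`»).
[cite: SimpsonporcoDorflerBullo2017, Appendix A proof of Theorem 3.4, eqs. (A.5)–(A.6) (p0019 L56–L66)] -/
theorem le_four_mul_sq_of_le_mul_sq {e a κ : ℝ} (he : 0 ≤ e) (ha : 0 ≤ a) (hκ : 0 ≤ κ)
    (h : e ≤ κ * (a + e) ^ 2) (hsmall : κ * (a + e) ≤ 1 / 2) : e ≤ 4 * κ * a ^ 2 := by
  have h1 : e ≤ (a + e) / 2 := by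
    calc e ≤ κ * (a + e) ^ 2 := h
      _ = (κ * (a + e)) * (a + e) := by ring
      _ ≤ (1 / 2) * (a + e) := mul_le_mul_of_nonneg_right hsmall (by positivity)
      _ = (a + e) / 2 := by ring
  have h2 : e ≤ a := by linarith
  calc e ≤ κ * (a + e) ^ 2 := h
    _ ≤ κ * (a + a) ^ 2 := by
        refine mul_le_mul_of_nonneg_left ?_ hκ
        exact pow_le_pow_left₀ (by positivity) (by linarith) 2
    _ = 4 * κ * a ^ 2 := by ring

/-- **Theorem 3.4, the quadratic error bound `‖ε‖ = O(‖Q_sc⁻¹Q_L‖²)`.**  Under the hypotheses of the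
implicit function theorem there is a constant `C ≥ 0` (`4‖Q_sc⁻¹‖‖Q_sc‖` in the proof) such that for
all sufficiently small `Q_L` the error coordinate of the high-voltage solution satisfies
`‖ε(Q_L)‖ ≤ C‖Q_sc⁻¹Q_L‖²`, where `E_L^{ZIP}(Q_L) = [E_L^{ZI}](𝟙 − Q_sc⁻¹Q_L + ε(Q_L))`.
[cite: SimpsonporcoDorflerBullo2017, §3.3 Theorem 3.4 («where `‖ε‖ = O(‖Q_sc⁻¹Q_L‖²)`») and Appendix A eqs. (A.4)–(A.6) («`‖ε‖ ≤ 4(β/α)‖q_L‖² = O(‖Q_sc⁻¹Q_L‖²)`», p0019 L50–L66)] -/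
theorem eventually_norm_zipError_le {bsh Ish : Fin n → ℝ} (hU : IsUnit (W.Bred + diagonal bsh).det)
    (hE : ∀ l, W.ziVoltage bsh Ish l ≠ 0) :
    ∃ C : ℝ, 0 ≤ C ∧ ∀ᶠ QL in 𝓝 (0 : Fin n → ℝ),
      ‖W.zipError bsh Ish QL (W.zipVoltage bsh Ish QL)‖ ≤ C * ‖(W.Qsc bsh Ish)⁻¹ *ᵥ QL‖ ^ 2 := by
  set κ : ℝ := ‖mulVecCLM (W.Qsc bsh Ish)⁻¹‖ * ‖mulVecCLM (W.Qsc bsh Ish)‖ with hκ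
  have hκ0 : 0 ≤ κ := by positivity
  refine ⟨4 * κ, by positivity, ?_⟩
  obtain ⟨h0, -, hsol, -⟩ := W.theorem_3_4_implicitFunction hU hE (N := 1)
  -- `q(Q_L) → 0` and `ε(Q_L) → 0`
  have hq : Tendsto (fun QL : Fin n → ℝ => (W.Qsc bsh Ish)⁻¹ *ᵥ QL) (𝓝 0) (𝓝 0) := by
    have h := (mulVecCLM (W.Qsc bsh Ish)⁻¹).continuous.tendsto (0 : Fin n → ℝ)
    rw [map_zero] at h
    exact h.congr fun QL => mulVecCLM_apply _ _
  have hεt : Tendsto (fun QL => W.zipError bsh Ish QL (W.zipVoltage bsh Ish QL)) (𝓝 0) (𝓝 0) := by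
    have hΦ := W.tendsto_zipVoltage hU hE
    rw [tendsto_pi_nhds]
    intro l
    have h1 : Tendsto (fun QL => W.zipVoltage bsh Ish QL l / W.ziVoltage bsh Ish l - 1)
        (𝓝 0) (𝓝 (W.ziVoltage bsh Ish l / W.ziVoltage bsh Ish l - 1)) :=
      (((continuous_apply l).continuousAt.tendsto.comp hΦ).div_const _).sub_const _
    rw [div_self (hE l), sub_self] at h1
    have h2 : Tendsto (fun QL : Fin n → ℝ => ((W.Qsc bsh Ish)⁻¹ *ᵥ QL) l) (𝓝 0) (𝓝 0) := by
      have := (continuous_apply l).continuousAt.tendsto.comp hq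
      simpa [Function.comp_def] using this
    have := h1.add h2
    simpa [zipError] using this
  have hsum : Tendsto (fun QL => κ * (‖(W.Qsc bsh Ish)⁻¹ *ᵥ QL‖
      + ‖W.zipError bsh Ish QL (W.zipVoltage bsh Ish QL)‖)) (𝓝 0) (𝓝 0) := by
    have := (hq.norm.add hεt.norm).const_mul κ
    simpa using this
  have hsmall : ∀ᶠ QL in 𝓝 (0 : Fin n → ℝ), κ * (‖(W.Qsc bsh Ish)⁻¹ *ᵥ QL‖
      + ‖W.zipError bsh Ish QL (W.zipVoltage bsh Ish QL)‖) ≤ 1 / 2 :=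
    hsum.eventually (eventually_le_nhds (by norm_num))
  filter_upwards [hsol, hsmall] with QL hR hs
  have hb := W.norm_zipError_le_mul_sq hU hE hR
  have hb' : ‖W.zipError bsh Ish QL (W.zipVoltage bsh Ish QL)‖
      ≤ κ * (‖(W.Qsc bsh Ish)⁻¹ *ᵥ QL‖ + ‖W.zipError bsh Ish QL (W.zipVoltage bsh Ish QL)‖) ^ 2 := by
    refine hb.trans (mul_le_mul_of_nonneg_left ?_ hκ0)
    exact pow_le_pow_left₀ (norm_nonneg _) (norm_sub_le _ _) 2
  exact le_four_mul_sq_of_le_mul_sq (norm_nonneg _) (norm_nonneg _) hκ0 hb' hs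

/-- **The derivative of the high-voltage solution at `Q_L = 0` is `−[E_L^{ZI}]Q_sc⁻¹`** — the
first-order term of (3.15): `E_L^{ZIP}(Q_L) = E_L^{ZI} − [E_L^{ZI}]Q_sc⁻¹Q_L + O(‖Q_L‖²)`.
[cite: SimpsonporcoDorflerBullo2017, §3.3 Theorem 3.4 eq. (3.15) and the discussion after it («a regular perturbation of the solution `E_L^{ZI}`», p0012 L18); §4.2 eq. (4.4) (the linearised load voltages)] -/
theorem hasFDerivAt_zipVoltage {bsh Ish : Fin n → ℝ} (hU : IsUnit (W.Bred + diagonal bsh).det)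
    (hE : ∀ l, W.ziVoltage bsh Ish l ≠ 0) :
    HasFDerivAt (W.zipVoltage bsh Ish)
      (-(LinearMap.toContinuousLinearMap
        (Matrix.toLin' (diagonal (W.ziVoltage bsh Ish) * (W.Qsc bsh Ish)⁻¹)))) 0 := by
  set E := W.ziVoltage bsh Ish with hEdef
  obtain ⟨C, hC, hbound⟩ := W.eventually_norm_zipError_le hU hE
  obtain ⟨h0, -, -, -⟩ := W.theorem_3_4_implicitFunction hU hE (N := 1)
  rw [← hEdef] at h0
  rw [hasFDerivAt_iff_isLittleO_nhds_zero]
  -- the remainder is `[E^{ZI}]ε(Q_L)`, bounded by `‖E^{ZI}‖ C ‖Q_sc⁻¹‖² ‖Q_L‖²`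
  have hrem : ∀ QL : Fin n → ℝ, W.zipVoltage bsh Ish (0 + QL) - W.zipVoltage bsh Ish 0
      - (-(LinearMap.toContinuousLinearMap (Matrix.toLin' (diagonal E * (W.Qsc bsh Ish)⁻¹)))) QL
      = fun l => E l * W.zipError bsh Ish QL (W.zipVoltage bsh Ish QL) l := by
    intro QL
    rw [zero_add, h0, _root_.neg_apply]
    have happ : (LinearMap.toContinuousLinearMap (Matrix.toLin' (diagonal E * (W.Qsc bsh Ish)⁻¹))) QL
        = fun l => E l * ((W.Qsc bsh Ish)⁻¹ *ᵥ QL) l := by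
      have : (LinearMap.toContinuousLinearMap (Matrix.toLin' (diagonal E * (W.Qsc bsh Ish)⁻¹))) QL
          = (diagonal E * (W.Qsc bsh Ish)⁻¹) *ᵥ QL := by simp [Matrix.toLin'_apply]
      rw [this, ← mulVec_mulVec]
      funext l
      rw [mulVec_diagonal]
    rw [happ]
    funext l
    simp only [Pi.sub_apply, Pi.neg_apply, zipError, ← hEdef]
    field_simp [hE l]
    ring
  refine Asymptotics.isLittleO_iff.2 fun c hc => ?_
  have hq2 : ∀ QL : Fin n → ℝ, ‖(W.Qsc bsh Ish)⁻¹ *ᵥ QL‖ ≤ ‖mulVecCLM (W.Qsc bsh Ish)⁻¹‖ * ‖QL‖ :=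
    fun QL => norm_mulVec_le _ _
  set K : ℝ := ‖E‖ * C * ‖mulVecCLM (W.Qsc bsh Ish)⁻¹‖ ^ 2 with hK
  have hK0 : 0 ≤ K := by positivity
  -- on a small ball `K‖Q_L‖ ≤ c`
  have hball : ∀ᶠ QL in 𝓝 (0 : Fin n → ℝ), K * ‖QL‖ ≤ c := by
    have : Tendsto (fun QL : Fin n → ℝ => K * ‖QL‖) (𝓝 0) (𝓝 0) := by
      have := (continuous_norm.tendsto (0 : Fin n → ℝ)).const_mul K
      simpa using this
    exact this.eventually (eventually_le_nhds hc)
  filter_upwards [hbound, hball] with QL hb hKc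
  rw [hrem QL]
  have hnn : 0 ≤ ‖E‖ * (C * ‖(W.Qsc bsh Ish)⁻¹ *ᵥ QL‖ ^ 2) := by positivity
  calc ‖fun l => E l * W.zipError bsh Ish QL (W.zipVoltage bsh Ish QL) l‖
        ≤ ‖E‖ * (C * ‖(W.Qsc bsh Ish)⁻¹ *ᵥ QL‖ ^ 2) := by
          refine (pi_norm_le_iff_of_nonneg hnn).2 fun l => ?_
          rw [norm_mul]
          exact mul_le_mul (norm_le_pi_norm E l) ((norm_le_pi_norm _ l).trans hb)
            (norm_nonneg _) (norm_nonneg _)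
    _ ≤ ‖E‖ * (C * (‖mulVecCLM (W.Qsc bsh Ish)⁻¹‖ * ‖QL‖) ^ 2) := by
          gcongr
          exact hq2 QL
    _ = (K * ‖QL‖) * ‖QL‖ := by rw [hK]; ring
    _ ≤ c * ‖QL‖ := mul_le_mul_of_nonneg_right hKc (norm_nonneg _)

/-! ## §4 Stability by continuity from the ZI case: the reduced Jacobian at `E_L^{ZIP}` is Hurwitz -/

/-- **The symmetrised reduced Jacobian at a solution with ZIP loads**:
`[E_L]⁻¹J_red(E_L) = B_red + [b_shunt] − [E_L]⁻²[Q_L]` (companion `symJacRed_of_reducedPowerFlow` with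
`Q_l'/E_l − Q_l(E_l)/E_l² = b_l − Q_l/E_l²`).
[cite: SimpsonporcoDorflerBullo2017, proof of Theorem 3.2 («moreover» part: `[E_L]⁻¹J_red = [E_L]⁻¹∂Q_L/∂E_L + B_red − [E_L]⁻²[Q_L(E_L)]`) applied to the ZIP model of §3.3] -/
theorem symJacRed_zip {bsh Ish QL EL : Fin n → ℝ} (hEL : ∀ l, EL l ≠ 0)
    (hR : W.ReducedPowerFlow (zipLoad bsh Ish QL) EL) :
    W.symJacRed (fun l => 2 * bsh l * EL l + Ish l) EL
      = W.Bred + diagonal bsh - diagonal fun l => QL l / EL l ^ 2 := by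
  rw [symJacRed_of_reducedPowerFlow _ hEL hR]
  ext i j
  simp only [Matrix.add_apply, Matrix.sub_apply, diagonal_apply, zipLoad]
  split_ifs with h
  · subst h
    field_simp [hEL i]
    ring
  · ring

/-- **Certificate form of Theorem 3.4's stability: `J_red(E_L^{ZIP})` is Hurwitz whenever
`−(B_red + [b_shunt]) + [E_L]⁻²[Q_L] ≻ 0`** at a positive solution `E_L` of (3.7) with ZIP loads and
`B` symmetric — one `n × n` `LDLᵀ` on data (automatic from Theorem 3.3 (i) when `Q_L ≥ 0`; a margin
condition `λ_min(−(B_red + [b_shunt])) > max_l |Q_l|/E_l²` for inductive demands `Q_L < 0`).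
[cite: SimpsonporcoDorflerBullo2017, §3.3 Theorem 3.4 («locally exponentially stable») with §3.2 Theorem 3.2 (`J_red` Hurwitz ⇒ stability; (3.10)); HornJohnson2013, §7.6 Thm. 7.6.1 (a)] -/
theorem jacRed_zip_isHurwitz_of_posDef {bsh Ish QL EL : Fin n → ℝ}
    (hEL : ∀ l, 0 < EL l) (hR : W.ReducedPowerFlow (zipLoad bsh Ish QL) EL)
    (hP : (-(W.Bred + diagonal bsh) + diagonal fun l => QL l / EL l ^ 2).PosDef) :
    IsHurwitz (W.jacRed (fun l => 2 * bsh l * EL l + Ish l) EL) := by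
  have hEL' : ∀ l, EL l ≠ 0 := fun l => (hEL l).ne'
  rw [jacRed_eq_diagonal_mul_symJacRed W _ hEL']
  refine isHurwitz_diagonal_mul_of_posDef_neg hEL ?_
  rwa [W.symJacRed_zip hEL' hR, neg_sub, sub_eq_neg_add]

/-- **«Exponential stability follows immediately by continuity from the case of ZI loads»**: under
Theorem 3.3 (i) `−(B_red + [b_shunt]) ≻ 0` (with `B` symmetric, `B_red + [b_shunt]` then invertible)
and `E_L^{ZI}` without zero entries, for all sufficiently small `Q_L` the certificate matrix
`−(B_red + [b_shunt]) + [E_L^{ZIP}]⁻²[Q_L]` is positive definite — positive definiteness is an OPEN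
condition and `E_L^{ZIP}(Q_L) → E_L^{ZI}`.
[cite: SimpsonporcoDorflerBullo2017, Appendix A proof of Theorem 3.4 («Exponential stability follows immediately by continuity from the case of ZI loads», p0019 L66)] -/
theorem eventually_posDef_zipCertificate {bsh Ish : Fin n → ℝ}
    (hA : (-(W.Bred + diagonal bsh)).PosDef) (hE : ∀ l, W.ziVoltage bsh Ish l ≠ 0) :
    ∀ᶠ QL in 𝓝 (0 : Fin n → ℝ),
      (-(W.Bred + diagonal bsh)
        + diagonal fun l => QL l / W.zipVoltage bsh Ish QL l ^ 2).PosDef := by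
  have hU : IsUnit (W.Bred + diagonal bsh).det := isUnit_det_of_posDef_neg'' hA
  set S : (Fin n → ℝ) → Matrix (Fin n) (Fin n) ℝ := fun QL =>
    -(W.Bred + diagonal bsh) + diagonal fun l => QL l / W.zipVoltage bsh Ish QL l ^ 2 with hS
  -- the certificate matrix depends continuously on `Q_L` at `0`, where it equals `−(B_red + [b])`
  have hΦ := W.tendsto_zipVoltage hU hE
  have hentry : ∀ l, Tendsto (fun QL : Fin n → ℝ => QL l / W.zipVoltage bsh Ish QL l ^ 2)
      (𝓝 0) (𝓝 0) := by
    intro l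
    have h1 : Tendsto (fun QL : Fin n → ℝ => QL l) (𝓝 0) (𝓝 0) := by
      have := (continuous_apply l).tendsto (0 : Fin n → ℝ)
      simpa using this
    have h2 : Tendsto (fun QL : Fin n → ℝ => W.zipVoltage bsh Ish QL l ^ 2) (𝓝 0)
        (𝓝 (W.ziVoltage bsh Ish l ^ 2)) :=
      ((continuous_apply l).continuousAt.tendsto.comp hΦ).pow 2
    have := h1.div h2 (pow_ne_zero 2 (hE l))
    rw [zero_div] at this
    exact this
  have h : Tendsto (fun QL : Fin n → ℝ => fun l => QL l / W.zipVoltage bsh Ish QL l ^ 2)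
      (𝓝 0) (𝓝 0) := tendsto_pi_nhds.2 hentry
  have key : Tendsto (fun q : Fin n → ℝ => diagonal q) (𝓝 0) (𝓝 0) :=
    continuous_id.matrix_diagonal.tendsto' 0 0 (by simp)
  have hSt : Tendsto S (𝓝 0) (𝓝 (-(W.Bred + diagonal bsh))) := by
    have := (key.comp h).const_add (-(W.Bred + diagonal bsh))
    rw [add_zero] at this
    exact this
  -- positivity of the quadratic form is open
  have hopen := (Literature.GroupTheory.ArithmeticGroups.isOpen_setOf_dotProduct_mulVec_pos (ι := Fin n))
  have hmem : -(W.Bred + diagonal bsh) ∈ {T : Matrix (Fin n) (Fin n) ℝ | ∀ v : Fin n → ℝ, v ≠ 0 → 0 < v ⬝ᵥ T *ᵥ v} := by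
    intro v hv
    have := hA.dotProduct_mulVec_pos hv
    simpa using this
  have hev : ∀ᶠ QL in 𝓝 (0 : Fin n → ℝ), S QL ∈ {T : Matrix (Fin n) (Fin n) ℝ | ∀ v : Fin n → ℝ, v ≠ 0 → 0 < v ⬝ᵥ T *ᵥ v} :=
    hSt.eventually_mem (hopen.mem_nhds hmem)
  filter_upwards [hev] with QL hQL
  refine PosDef.of_dotProduct_mulVec_pos (hA.isHermitian.add (isHermitian_diagonal _)) fun v hv => ?_
  rw [star_trivial]
  exact hQL v hv

/-- **For all sufficiently small `Q_L`, `J_red(E_L^{ZIP}(Q_L))` is Hurwitz** (Theorem 3.3 (i)–(ii); the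
symmetry of `B_red` is part of (i)). [cite: SimpsonporcoDorflerBullo2017, §3.3 Theorem 3.4 («locally exponentially stable») and Appendix A (p0019 L66: «by continuity from the case of ZI loads»)] -/
theorem eventually_jacRed_zipVoltage_isHurwitz {bsh Ish : Fin n → ℝ}
    (hA : (-(W.Bred + diagonal bsh)).PosDef) (hZ : IsZMatrix (-(W.Bred + diagonal bsh)))
    (hI : ∀ l, W.redSource l < Ish l) :
    ∀ᶠ QL in 𝓝 (0 : Fin n → ℝ),
      (∀ l, 0 < W.zipVoltage bsh Ish QL l) ∧
      W.ReducedPowerFlow (zipLoad bsh Ish QL) (W.zipVoltage bsh Ish QL) ∧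
      IsHurwitz (W.jacRed (fun l => 2 * bsh l * W.zipVoltage bsh Ish QL l + Ish l)
        (W.zipVoltage bsh Ish QL)) := by
  obtain ⟨hpos, -, -, -⟩ := theorem_3_3_ziLoads hA hZ hI
  have hE : ∀ l, W.ziVoltage bsh Ish l ≠ 0 := fun l => (hpos l).ne'
  have hU : IsUnit (W.Bred + diagonal bsh).det := isUnit_det_of_posDef_neg'' hA
  obtain ⟨-, -, hsol, -⟩ := W.theorem_3_4_implicitFunction hU hE (N := 1)
  have hΦ := W.tendsto_zipVoltage hU hE
  have hposev : ∀ᶠ QL in 𝓝 (0 : Fin n → ℝ), ∀ l, 0 < W.zipVoltage bsh Ish QL l := by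
    refine eventually_all.2 fun l => ?_
    exact ((continuous_apply l).continuousAt.tendsto.comp hΦ).eventually_const_lt (hpos l)
  filter_upwards [hposev, hsol, W.eventually_posDef_zipCertificate hA hE] with QL hp hR hP
  exact ⟨hp, hR, W.jacRed_zip_isHurwitz_of_posDef hp hR hP⟩

/-! ## §5 Assembly: Theorem 3.4 at the reduced tier and at the DAE tier (Theorem 3.2) -/

/-- **Theorem 3.4 (Stability with "ZIP" Loads), reduced tier, assembled.**  Let the conditions of
Theorem 3.3 hold — (i) `−(B_red + [b_shunt])` an `M`-matrix (symmetric: positive definite with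
nonpositive off-diagonal entries), (ii) `I_shunt > B_redE_L*` — and `B` symmetric.  Then the
high-voltage solution map `E_L^{ZIP} = zipVoltage` satisfies: `E_L^{ZIP}(0) = E_L^{ZI}`; it is `C¹` at
`0`; for ALL SUFFICIENTLY SMALL `Q_L`: `E_L^{ZIP}(Q_L) ∈ ℝ^n_{>0}` solves the reduced power flow equation
with ZIP loads and `J_red(E_L^{ZIP}(Q_L))` is Hurwitz (Theorem 3.2's stability hypothesis); near
`(0, E_L^{ZI})` the solutions of (3.7) are exactly the graph of `E_L^{ZIP}` (local uniqueness); and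
`E_L^{ZIP}(Q_L) = [E_L^{ZI}](𝟙 − Q_sc⁻¹Q_L + ε(Q_L))` with `‖ε(Q_L)‖ ≤ C‖Q_sc⁻¹Q_L‖²` for small `Q_L`.
[cite: SimpsonporcoDorflerBullo2017, §3.3 Theorem 3.4 (p0012 L1–L13) with Appendix A (p0019 L25–L66)] -/
theorem theorem_3_4_zipLoads {bsh Ish : Fin n → ℝ}
    (hA : (-(W.Bred + diagonal bsh)).PosDef) (hZ : IsZMatrix (-(W.Bred + diagonal bsh)))
    (hI : ∀ l, W.redSource l < Ish l) :
    W.zipVoltage bsh Ish 0 = W.ziVoltage bsh Ish ∧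
      ContDiffAt ℝ 1 (W.zipVoltage bsh Ish) 0 ∧
      (∀ᶠ QL in 𝓝 (0 : Fin n → ℝ),
        (∀ l, 0 < W.zipVoltage bsh Ish QL l) ∧
        W.ReducedPowerFlow (zipLoad bsh Ish QL) (W.zipVoltage bsh Ish QL) ∧
        IsHurwitz (W.jacRed (fun l => 2 * bsh l * W.zipVoltage bsh Ish QL l + Ish l)
          (W.zipVoltage bsh Ish QL))) ∧
      (∀ᶠ p in 𝓝 ((0 : Fin n → ℝ), W.ziVoltage bsh Ish),
        W.ReducedPowerFlow (zipLoad bsh Ish p.1) p.2 ↔ W.zipVoltage bsh Ish p.1 = p.2) ∧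
      (∀ QL, W.zipVoltage bsh Ish QL = fun l => W.ziVoltage bsh Ish l
        * (1 - ((W.Qsc bsh Ish)⁻¹ *ᵥ QL) l + W.zipError bsh Ish QL (W.zipVoltage bsh Ish QL) l)) ∧
      ∃ C : ℝ, 0 ≤ C ∧ ∀ᶠ QL in 𝓝 (0 : Fin n → ℝ),
        ‖W.zipError bsh Ish QL (W.zipVoltage bsh Ish QL)‖ ≤ C * ‖(W.Qsc bsh Ish)⁻¹ *ᵥ QL‖ ^ 2 := by
  obtain ⟨hpos, -, -, -⟩ := theorem_3_3_ziLoads hA hZ hI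
  have hE : ∀ l, W.ziVoltage bsh Ish l ≠ 0 := fun l => (hpos l).ne'
  have hU : IsUnit (W.Bred + diagonal bsh).det := isUnit_det_of_posDef_neg'' hA
  obtain ⟨h0, h1, -, hiff⟩ := W.theorem_3_4_implicitFunction hU hE (N := 1)
  exact ⟨h0, h1, W.eventually_jacRed_zipVoltage_isHurwitz hA hZ hI, hiff,
    fun QL => W.eq_coordinates_zipError hE QL _, W.eventually_norm_zipError_le hU hE⟩

section DAE

/-- The equilibrium `(E_L^{ZIP}, E_I^{ZIP})` of the closed loop (3.3) with ZIP loads, `E_I^{ZIP} =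
W₂(E_L^{ZIP}, E_I*)`. [cite: SimpsonporcoDorflerBullo2017, §3.3 Theorem 3.4 («the corresponding equilibrium point `(E_L^{ZIP}, E_I^{ZIP})` of (3.3)») with Theorem 3.1 eq. (3.8)] -/
def zipState (bsh Ish QL : Fin n → ℝ) : Fin n ⊕ Fin m → ℝ := W.liftState (W.zipVoltage bsh Ish QL)

/-- **Theorem 3.4, DAE tier** (matrix-level data as in Proposition 7.2: `B` symmetric, off-diagonal
entries `≥ 0`, zero row sums, `−(B + blkdiag(0, K_I)) ≻ 0`, `K_i ≤ 0`, `E_i* > 0`; `τ_i > 0`; Theorem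
3.3's (i) `−(B_red + [b_shunt])` an `M`-matrix and (ii) `I_shunt > B_redE_L*`).  For ALL SUFFICIENTLY
SMALL constant-power demands `Q_L`: the equilibrium `(E_L^{ZIP}, E_I^{ZIP})` of the closed loop (3.3)
with ZIP loads lies in `ℝ^{n+m}_{>0}`, and it is locally exponentially stable in the sense of Theorem
3.2's DAE tier — there are `ρ, k, λ > 0` such that every C¹ solution of the DAE on `[0, T]` starting
within `ρ` of it obeys `‖E(t) − E^{ZIP}‖ ≤ k‖E(0) − E^{ZIP}‖e^{−λt}`; moreover from every consistent
initial state within `ρ` a C¹ solution on `[0, ∞)` with this estimate EXISTS, and DAE solutions with a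
common consistent initial state close to `E^{ZIP}` are UNIQUE.
[cite: SimpsonporcoDorflerBullo2017, §3.3 Theorem 3.4 («the corresponding equilibrium point `(E_L^{ZIP}, E_I^{ZIP})` of (3.3) is locally exponentially stable», p0012 L11–L13) with §3.2 Theorem 3.2 and §7 Proposition 7.2; Riaza2008, §3.1; Khalil2002, Theorem 4.7] -/
theorem theorem_3_4_locallyExpStable {bsh Ish : Fin n → ℝ} (hB : W.B.IsSymm)
    (hoff : ∀ k k', k ≠ k' → 0 ≤ W.B k k') (hrowB : ∀ k, ∑ k', W.B k k' = 0)
    (hM : (-(W.B + Matrix.fromBlocks 0 0 0 (diagonal W.K))).PosDef) (hK : ∀ i, W.K i ≤ 0)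
    (hEs : ∀ i, 0 < W.Estar i) (hτ : ∀ i, 0 < W.τ i) (hA : (-(W.Bred + diagonal bsh)).PosDef)
    (hZ : IsZMatrix (-(W.Bred + diagonal bsh))) (hI : ∀ l, W.redSource l < Ish l) :
    ∀ᶠ QL in 𝓝 (0 : Fin n → ℝ),
      (∀ k, 0 < W.zipState bsh Ish QL k) ∧
      W.IsEquilibrium (zipLoad bsh Ish QL) (W.zipState bsh Ish QL) ∧
      (∃ ρ > 0, ∃ k > 0, ∃ lam > 0, ∀ (E : ℝ → Fin n ⊕ Fin m → ℝ) (T : ℝ),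
        W.IsDAESolutionOn (zipLoad bsh Ish QL) E T → ‖E 0 - W.zipState bsh Ish QL‖ < ρ →
          ∀ t ∈ Icc (0 : ℝ) T,
            ‖E t - W.zipState bsh Ish QL‖ ≤ k * ‖E 0 - W.zipState bsh Ish QL‖ * Real.exp (-lam * t)) ∧
      (∃ ρ > 0, ∃ k > 0, ∃ lam > 0, ∀ x : Fin n ⊕ Fin m → ℝ, ‖x - W.zipState bsh Ish QL‖ < ρ →
        (∀ l, W.closedLoop (zipLoad bsh Ish QL) x (Sum.inl l) = 0) →
        ∃ E : ℝ → Fin n ⊕ Fin m → ℝ, E 0 = x ∧ (∀ T : ℝ, W.IsDAESolutionOn (zipLoad bsh Ish QL) E T) ∧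
          ∀ t : ℝ, 0 ≤ t →
            ‖E t - W.zipState bsh Ish QL‖ ≤ k * ‖x - W.zipState bsh Ish QL‖ * Real.exp (-lam * t)) ∧
      (∃ ρ > 0, ∀ (E₁ E₂ : ℝ → Fin n ⊕ Fin m → ℝ) (T : ℝ),
        W.IsDAESolutionOn (zipLoad bsh Ish QL) E₁ T → W.IsDAESolutionOn (zipLoad bsh Ish QL) E₂ T →
        E₁ 0 = E₂ 0 → ‖E₁ 0 - W.zipState bsh Ish QL‖ < ρ → ∀ t ∈ Icc (0 : ℝ) T, E₁ t = E₂ t) := by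
  have hII := posDef_neg_BIIK_of_posDef_aug hM
  have hU' : IsUnit W.BIIK.det := isUnit_BIIK_det_of_posDef hII
  obtain ⟨-, -, ⟨hW2nn, hW2one⟩, -⟩ := proposition_7_2 hB hoff hrowB hM hK hEs
  filter_upwards [W.eventually_jacRed_zipVoltage_isHurwitz hA hZ hI] with QL hQL
  obtain ⟨hpos, hR, hH⟩ := hQL
  set EL := W.zipVoltage bsh Ish QL with hELdef
  have hEI : ∀ i, 0 < W.invVoltage EL i := fun i => invVoltage_pos hW2nn hW2one hEs hpos i
  set dQf : Fin n → ℝ → ℝ := fun l e => 2 * bsh l * e + Ish l with hdQf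
  have hQ : ∀ l e, HasDerivAt (zipLoad bsh Ish QL l) (dQf l e) e := fun l e =>
    hasDerivAt_zipLoad bsh Ish QL l e
  have hQL1 : ∀ l, ContDiff ℝ 1 (zipLoad bsh Ish QL l) := fun l => contDiff_zipLoad bsh Ish QL l
  have hdQf1 : ∀ l, ContDiff ℝ 1 (dQf l) := fun l => contDiff_zipLoad_deriv bsh Ish l
  have hcont : ∀ l, ContinuousAt (dQf l) (EL l) := fun l => (hdQf1 l).continuous.continuousAt
  have hH' : IsHurwitz (W.jacRed (fun l => dQf l (EL l)) EL) := hH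
  refine ⟨?_, ?_, ?_, ?_, ?_⟩
  · intro k
    cases k with
    | inl l => exact hpos l
    | inr i => exact hEI i
  · exact isEquilibrium_of_reducedPowerFlow hU' hR
  · exact theorem_3_2_locallyExpStable hB hII hτ hpos hEI hR
      (fun l => Eventually.of_forall fun e => hQ l e) hcont hH'
  · exact exists_daeSolution_expStable hB hII hτ hpos hEI hR hQL1 hdQf1 hQ hH'
  · exact daeSolution_unique hB hII hτ hpos hEI hR hQL1 hdQf1 hQ hH'

/-- **Theorem 3.4, DAE tier, from network data.**  Connected inductive network (`w` symmetric,
`w ≥ 0`, `BranchConnected w`, `B = susceptanceMatrix w`), quadratic droop gains `K_i < 0`, set points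
`E_i* > 0`, time constants `τ_i > 0`, at least one inverter; Theorem 3.3's (i) `−(B_red + [b_shunt]) ≻ 0`
(its `Z`-sign pattern is automatic) and (ii) `I_shunt > B_redE_L*`.  Then for all sufficiently small
constant-power demands `Q_L` the conclusions of `theorem_3_4_locallyExpStable` hold for the ZIP loads
`Q_l(E_l) = b_lE_l² + I_lE_l + Q_l`.
[cite: SimpsonporcoDorflerBullo2017, §3.3 Theorem 3.4 with §3.2 Theorem 3.2, §7 Lemma 7.1 and Proposition 7.2; Riaza2008, §3.1] -/
theorem theorem_3_4_locallyExpStable_of_network {w : Fin n ⊕ Fin m → Fin n ⊕ Fin m → ℝ}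
    {bsh Ish : Fin n → ℝ} (hw : ∀ i j, w i j = w j i) (hw0 : ∀ i j, 0 ≤ w i j)
    (hconn : BranchConnected w) (hBw : W.B = susceptanceMatrix w) (hK : ∀ i, W.K i < 0)
    (hm : 0 < m) (hEs : ∀ i, 0 < W.Estar i) (hτ : ∀ i, 0 < W.τ i)
    (hA : (-(W.Bred + diagonal bsh)).PosDef) (hI : ∀ l, W.redSource l < Ish l) :
    ∀ᶠ QL in 𝓝 (0 : Fin n → ℝ),
      (∀ k, 0 < W.zipState bsh Ish QL k) ∧
      W.IsEquilibrium (zipLoad bsh Ish QL) (W.zipState bsh Ish QL) ∧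
      (∃ ρ > 0, ∃ k > 0, ∃ lam > 0, ∀ (E : ℝ → Fin n ⊕ Fin m → ℝ) (T : ℝ),
        W.IsDAESolutionOn (zipLoad bsh Ish QL) E T → ‖E 0 - W.zipState bsh Ish QL‖ < ρ →
          ∀ t ∈ Icc (0 : ℝ) T,
            ‖E t - W.zipState bsh Ish QL‖ ≤ k * ‖E 0 - W.zipState bsh Ish QL‖ * Real.exp (-lam * t)) ∧
      (∃ ρ > 0, ∃ k > 0, ∃ lam > 0, ∀ x : Fin n ⊕ Fin m → ℝ, ‖x - W.zipState bsh Ish QL‖ < ρ →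
        (∀ l, W.closedLoop (zipLoad bsh Ish QL) x (Sum.inl l) = 0) →
        ∃ E : ℝ → Fin n ⊕ Fin m → ℝ, E 0 = x ∧ (∀ T : ℝ, W.IsDAESolutionOn (zipLoad bsh Ish QL) E T) ∧
          ∀ t : ℝ, 0 ≤ t →
            ‖E t - W.zipState bsh Ish QL‖ ≤ k * ‖x - W.zipState bsh Ish QL‖ * Real.exp (-lam * t)) ∧
      (∃ ρ > 0, ∀ (E₁ E₂ : ℝ → Fin n ⊕ Fin m → ℝ) (T : ℝ),
        W.IsDAESolutionOn (zipLoad bsh Ish QL) E₁ T → W.IsDAESolutionOn (zipLoad bsh Ish QL) E₂ T →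
        E₁ 0 = E₂ 0 → ‖E₁ 0 - W.zipState bsh Ish QL‖ < ρ → ∀ t ∈ Icc (0 : ℝ) T, E₁ t = E₂ t) := by
  have hB : W.B.IsSymm := by rw [hBw]; exact susceptanceMatrix_isSymm hw
  have hoff : ∀ k k', k ≠ k' → 0 ≤ W.B k k' := fun k k' hkk' => by
    rw [hBw]; exact susceptanceMatrix_offDiag_nonneg hw0 hkk'
  have hrowB : ∀ k, ∑ k', W.B k k' = 0 := fun k => by
    rw [hBw]; exact sum_susceptanceMatrix_row w k
  have hM := posDef_neg_aug_of_branchConnected hw hw0 hconn hBw hK hm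
  have hII := posDef_neg_BIIK_of_posDef_aug hM
  obtain ⟨-, -, hZ⟩ := stieltjes_neg_Bred hB hoff hM bsh
  exact W.theorem_3_4_locallyExpStable hB hoff hrowB hM (fun i => (hK i).le) hEs hτ hA hZ hI

end DAE

end QuadDroopNetwork

end Literature.MathematicalPhysics.PowerSystems
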